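/-
Origin: expansion seat `planner-pub-hodgecm-mc-axioms-1-g14-0`, handover #W41 2026-08-20T15:53:55Z md5 3446e2c36cc5 (PKG a1b9950553cb → 3446e2c36cc5; 534 l.; MECHANICAL (iib-R) rewrite v3.1 of the PKG file as it stands (99 token edits; rules R9+R9+R9+R1x3+R2x5+RX[h₂]x33+RX[h₂']x46+R3x3+R8x4)) (`HOME/mc/pub-hodgecm-mc-axioms-1-g14/revendor/kit-r55/stage55/HodgeCM/Model/ThetaSpaceInputPin.lean`, md5 3446e2c36cc5, 534 lines);
landed by the gen-22 packager (p-g22) in gate run 55 REPLACES the earlier landed copy of `HodgeCM/Model/ThetaSpaceInputPin.lean` (seat copy carried the packager Origin header of an earlier run (stripped)).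
-/
/-
RUN-38 (L3)/(L3b) `Level`-PAIR RE-CUT DRAFT by `planner-pub-hodgecm-mc-theta-3-g10-0` 2026-08-19 over RUN-37 kit #S8 35f4f2b9a0fa (model1
BINDER-TRIAGE §69.2: «(L3) home := PIN FIELD, no new E binder»; period-1-g9 l.11726/l.11760; binder-1-g8 l.11730): + structure fields
`ThetaAdelicSide.fin_mem_Gfin` ((L3b): the translating elements `e(1, k_f⁻¹)` lie in `Gfin`) and `ThetaAdelicSide.rat_split_level`
((L3): LEVEL-WISE rational splitting with corrector in the saturation regime `satLevelRegimeOf V hV K`); + `ballDatumOf_Γ_map`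
MOVED UP verbatim from `Model/ThetaSatDischarge` (same name, same namespace); + pin lemma `exists_toBall_eq_of_mem_levelImage`
(level images come from level-`Γ.K` rational points, via (W1) `Level.arithmeticLevel_K`) and `ThetaAdelicSide.exists_corrector_of_mem_levelImage`
(= verbatim the residual hypothesis `hcorr` of #S11's (T4)); everything else byte-identical to #S8.
-/
/-
(Θ-sat)/(W1) RE-STAGE DRAFT by `planner-pub-hodgecm-mc-theta-3-g9-0` 2026-08-19 over the installed bytes 192675310ee3 (RUN-37 `Level`-pair /
(Θ-sat) pin packet, BINDER-TRIAGE §57/§60/§61, theta-3-g8 HANDOFF §7a.PIN): + `import HodgeCM.Model.Junction.LevelSaturation` (mc-discharge-1,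
t36 #3 2469199ca0a4; light: `AdelicUnitaryModel` + tree twins), + field `KΓ := fun Γ => satLevelRegimeOf V h Γ.K` in `thetaSpaceInputIn` (the
saturation index of the level = the image in the regime model of `awayFromCM ⊓ M_{Γ.K}`: a choice-free function of the PAIR `(Γ, K)` of (W1)
`CM/Basic` #342, antitone along the `K`-order by `satLevelRegimeOf_mono`) and `KΓ := fun _ => ⊥` in `thetaSpaceInputOff`, + `@[simp]
thetaSpaceInputIn_KΓ`; everything else byte-identical.  Needs the re-staged `Model/ThetaClassInputInstance` (field `ThetaSpaceInput.KΓ`,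
`Θ := thetaSpaceSatOf …`).
-/
/-
Origin: expansion seat `planner-pub-hodgecm-mc-theta-3-g4-0`, handover M1 = theta-3 #6″ md5 5a6bf8038289 (v2 pin: level-free ιinf : U21 →* GU, hRat field; rehearsal theta-3-g4 olean2 rc 0 05:24:54Z) (`HOME/mc/pub-hodgecm-mc-theta-3-g4/lean/next/HodgeCM/Model/ThetaSpaceInputPin.lean`, md5 5a6bf803, 409 lines);
landed by the gen-11 packager (p-g11) in gate run 35 REPLACES the earlier landed copy of `HodgeCM/Model/ThetaSpaceInputPin.lean` (verbatim).
-/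
/-
Copyright (c) 2026. Released under Apache 2.0 license as described in the file LICENSE.
Cell pub-hodgecm, MODEL layer (construction prover mc-theta-3, gen 3), node T3-classPacks / E binder `X`:
the PIN of the classical theta-space input `X := (B)` of the END STATE model.
-/
import Summits.HodgeConjecture.HodgeCM.Model.ArchKType
import Summits.HodgeConjecture.HodgeCM.Model.BallInstance
import Summits.HodgeConjecture.HodgeCM.Model.ClassMapInstance
import Summits.HodgeConjecture.HodgeCM.Model.Junction.LevelSaturation

/-!
# The pin `X := (B)` of the theta-space input (E binder `X : ∀ V c, ThetaSpaceInput U V c`)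

`Model/ThetaClassInputInstance` types the E-side input `X V c : ThetaSpaceInput U V c` (pure data: the
classical archimedean situation `G₁ ⊇ K₁`, weight `τ₁` on `W`, level groups `Δ Γ`, class-map data `D Γ`, and
the adelic side `K, L, J, GU, P k, ιinf Γ`).  This file PINS its geometric half on the model universe
`U := picardCMUniverse hHD hI h₁ h₃` (carver ruling (J-lvl′), design (B)):

* `G₁ := U(2,1) = U21`, `K₁ := Stab(x₀)`, `κ₁ :=` inclusion, `W := ℂ²`, `τ₁ := weightOf x₀` of the cotangent
  cocycle (tree `BallForms.isPullbackCocycle_cotangentCocycle`);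
* IN THE REGIME `h : IsAnisotropic L V.Hm` (always when `2 < [L:ℚ]`, `isAnisotropic_of_two_lt`; the only branch
  the PerL cone evaluates): `Δ Γ := (ballDatumOf … Γ h).ballImage 𝔣_Γ` for the UNIFORM Sylvester frame
  `𝔣_Γ := frameOf … Γ h := Model.ballFrame … Γ h` (period lane, `Model/BallInstance`: matrix `V.sylvesterFrame`
  at every level), and **`D Γ := Model.classMapDatumOf hHD hI h₁ h₃ Γ h
  𝔣_Γ (MonoidHom.id U21) (isLevelCorrected_id …) (isWeightMatched_id …)`** — node D1-aut CLASSMAP (C2)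
  (autform-2, `Model/ClassMapInstance`: `pull` injective, `descends` a theorem, `H10 = F¹H¹(X_Γ)`);
* OFF THE REGIME: `Δ Γ := ⊥` and `D Γ := zeroClassMapDatum …` (`H10 = ⊥`, `Hol = ⊥`; theta classes `= {0}`,
  `thetaClasses_zeroClassMapDatum`) — nothing is ever asserted there (same convention as `Model.embOf`);
* the ADELIC half is received as ONE named sub-binder **`S : ThetaAdelicSide V c`** = {`P : Fin 4 → WeilPairData L⁺ L
  (Fin 3) G_U(𝔸)` over the regime model group `G_U(𝔸) := (V.latticeModel printFact_unitaryCompact_holds).G` with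
  `(P k).ΓU =` its rational points (`hΓU`) — the Weil representations of the pairs `U(V) × U(W_k)` (owner: unitary-1 /
  weil lanes; record Prop-fields (W-wt) / (W-maj⁺) / (W-rat⁺) = Weil 1964 print rows) — and `ιinf : U21 →*
  G_U(𝔸)`, the archimedean component in the uniform frame (level-free since the RUN-34 revision)};
  `instCompact` is then the regime
  model's cocompactness (KERNEL: `printFact_unitaryCompact_holds`, Godement), transported along `hΓU`.

Main definitions: `zeroClassMapDatum`, `ThetaAdelicSide`, `frameOf`, `thetaSpaceInputIn` (regime branch),
`thetaSpaceInputOff`, **`thetaSpaceInputOf hHD hI h₁ h₃ S V c : ThetaSpaceInput U V c`** (the pin; `dite` on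
the regime), `thetaSpaceInputOf_of_isAnisotropic` (`dif_pos`), `thetaOf_thetaSpaceInputOf_of_isAnisotropic`
(the END STATE's `Θ_k(Γ)` at the pin, in the regime, is `thetaClasses id (classMapDatumOf …) (thetaSpaceOf (P k) …)`),
and the `Nonempty`-level producer `classPacksOf_nonempty` (E's `classPacks` from `∀ …, Nonempty (SupplySituationAt
(X V c) k N)` — so that regime transports stay propositional); § 5 `isAnisotropic_of_goodCtx` (a good SEXTIC
context forces the regime: `c.K ↪ L` gives `4 ≤ 6 ≤ [L:ℚ]`) and **`classPacksOf_pin`** = E's `classPacks` AT THE PIN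
from `C : ∀ V c (hV : regime), GoodCtx → [K:ℚ] = 6 → ∀ k ∈ {0,1}, ∀ N > 0, ArchKTypeData (thetaSpaceInputIn … (S V c) hV)
k N` (`Model/ArchKType`) and the holomorphy `hol` of its restricted theta forms ((W6b-hol)).

Nothing is cited and nothing is minted: definitions and kernel lemmas; the sub-binder `S` is data.
-/

set_option autoImplicit false

noncomputable section

open MulAction NumberField
open Literature.Geometry.ComplexHyperbolic.BallModel (U21 Ball x₀)
open Literature.NumberTheory.Automorphic Literature.NumberTheory.Weil1964
open Literature.NumberTheory.Automorphic.WeightForms (ClassMapDatum thetaClasses restrictHom IsLevelCorrected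
  IsWeightMatched)
open Literature.AlgebraicGeometry.HodgeTheory
open Literature.AlgebraicGeometry.ShimuraVarieties
open Literature.NumberTheory.Automorphic.PicardCM
open HodgeCM.Model.SupplyResidual
open HodgeCM.Model.ThetaSpace

namespace HodgeCM
namespace Model

/-! ### § 1. The zero class-map datum (off-regime branch) -/

section Zero

variable {GU : Type*} [Group GU] {Kc : Type*} [Group Kc] {ΓU : Subgroup GU} {κ : Kc →* GU}
  {W : Type*} [AddCommGroup W] [Module ℂ W] {τ : Representation ℂ Kc W}
  {G₁ : Type*} [Group G₁] {K₁ : Type*} [Group K₁] (ι : G₁ →* GU) {Δ : Subgroup G₁} {κ₁ : K₁ →* G₁}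
  {τ₁ : Representation ℂ K₁ W} (hΔ : IsLevelCorrected ΓU κ τ ι Δ) {η₁ : K₁ →* Kc}
  (hη : IsWeightMatched κ τ ι κ₁ τ₁ η₁) (H : Type*) [AddCommGroup H] [Module ℂ H]

/-- **The zero class-map datum**: no `(1,0)`-classes, no holomorphic forms. -/
def zeroClassMapDatum : ClassMapDatum ι hΔ hη H where
  H10 := ⊥
  pull := 0
  Hol := ⊥
  descends f hf := ⟨0, by rw [(Submodule.mem_bot ℂ).mp hf, map_zero]⟩

/-- (Ported verbatim from the HodgeCMPerL package; no docstring in the source.) -/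
@[simp] theorem zeroClassMapDatum_H10 : (zeroClassMapDatum ι hΔ hη H).H10 = ⊥ := rfl
/-- (Ported verbatim from the HodgeCMPerL package; no docstring in the source.) -/
@[simp] theorem zeroClassMapDatum_Hol : (zeroClassMapDatum ι hΔ hη H).Hol = ⊥ := rfl

/-- The theta classes through the zero datum are `{0}`, whatever the theta space. -/
theorem thetaClasses_zeroClassMapDatum (Θ : Submodule ℂ (weightForms ΓU κ τ)) :
    thetaClasses ι (zeroClassMapDatum ι hΔ hη H) Θ = {0} := by
  ext h
  simp only [WeightForms.mem_thetaClasses_iff, Set.mem_singleton_iff]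
  constructor
  · rintro ⟨c, rfl, -⟩
    exact (Submodule.mem_bot ℂ).mp c.2
  · rintro rfl
    refine ⟨0, rfl, 0, Θ.zero_mem, ?_, ?_⟩
    · rw [map_zero]; exact Submodule.zero_mem _
    · rw [map_zero, map_zero]

end Zero

/-! ### § 2. The adelic side (sub-binder `S`) -/

/-- **The adelic side of the theta-space input** over the regime model `G_U(𝔸) := (V.latticeModel _).G`:
the pair data `P k` (Weil representations of `U(V) × U(W_k)`, `k : Fin 4`) with `Γ_U =` the model's rational
points, and the archimedean component `ιinf : U(2,1) →* G_U(𝔸)` in the uniform frame (level-free, RUN-34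
revision after period-1-g3 2026-08-19T01:39:45Z: E's `hι` becomes `rfl`). DATA. -/
structure ThetaAdelicSide {L : CMField} {ι₁ : L →+* ℂ} (V : HermSpace3 L ι₁) (c : SeesawCtx L) : Type 1 where
  /-- the pair data of `(U(V), U(W_k))` on `𝒮(𝔸_{L⁺}^3)` -/
  P : Fin 4 → WeilPairData (maximalRealSubfield L) L (Fin 3) (V.latticeModel printFact_unitaryCompact_holds).G
  /-- their arithmetic subgroup is `G_U(L⁺)` of the regime model -/
  hΓU : ∀ k : Fin 4, (P k).ΓU = (V.latticeModel printFact_unitaryCompact_holds).Γ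
  /-- the archimedean component `U(2,1) = U(V)(ℝ)_{ι₁} → G_U(𝔸)` in the uniform frame (level-free) -/
  ιinf : U21 →* (V.latticeModel printFact_unitaryCompact_holds).G
  /-- the finite-adelic factor `G_U(𝔸_f) ≤ G_U(𝔸)` (arch × fin splitting, RUN-34 revision after period-1-g3
  2026-08-19T02:13:17Z (c) / glue-1-g4 02:19:23Z: `ιinf` IS the archimedean-factor inclusion) -/
  Gfin : Subgroup (V.latticeModel printFact_unitaryCompact_holds).G
  /-- the finite factor commutes with the archimedean one -/
  comm_fin : ∀ (x : U21), ∀ k ∈ Gfin, Commute k (ιinf x)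
  /-- a rational point `γ ∈ U(V)(L⁺) ⊂ U(2,1)` (uniform frame) is, up to its finite-adelic component, a point of the
  arithmetic subgroup `G_U(L⁺) ≤ G_U(𝔸)` of the regime model: `ιinf γ · γ_f ∈ G_U(L⁺)` -/
  rat_split : ∀ γ ∈ BallRational.ratImage L ι₁ V.Hm V.sylvesterFrame (sylvesterFrame_J V),
    ∃ k ∈ Gfin, ιinf γ * k ∈ (V.latticeModel printFact_unitaryCompact_holds).Γ
  /-- **(L3b)** the finite-adelic translating elements `e(1, k_f⁻¹) ∈ G_U(𝔸)` of the (Θ-sat)/(T4) right translation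
  (kit #S11 `finTranslate V hV kf`, reducibly this very term) lie in the finite factor `Gfin` — a PIN FIELD (model1 §69.2),
  fed at the honest term by period-1's `regimeEquiv_prodSymm_one_mem_archFinOf` (RUN-38 `Level`-pair packet). -/
  fin_mem_Gfin : ∀ (hV : IsAnisotropic L V.Hm) (kf : V.adelicFin),
    HodgeCM.Adelic.regimeEquiv L V.Hm hV
        ((Literature.NumberTheory.Automorphic.UnitaryGroup.cmAdelicProdEquiv (L : Type) 3 V.Hm).symm (1, kf⁻¹)) ∈ Gfin
  /-- **(L3)** LEVEL-WISE rational splitting: a rational point of finite level `K` (`g ∈ U(V)(L⁺) ∩ K`, read in `U(2,1)`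
  along the uniform Sylvester frame) has a corrector IN THE SATURATION REGIME of `K` (`awayFromCM ⊓ M_K` read in the regime
  model, `satLevelRegimeOf V hV K`) into the arithmetic subgroup, commuting with the archimedean component — a PIN FIELD
  (model1 §69.2); instance at the honest term = period-1's `ArchSideLevel` over the tree's `UnitaryGroupAwayLevel`
  (`exists_archSectionU21CM_mul_mem_adelicUnitaryRat_of_mem_arithmeticLevel`, `commute_archSectionU21CM_of_mem_awayLevelCM`). -/
  rat_split_level : ∀ (hV : IsAnisotropic L V.Hm) (K : Subgroup V.adelicFin)
      (g : ↥(Literature.AlgebraicGeometry.ShimuraVarieties.unitaryGroup (IsCMField.complexConj L : L →+* L) V.Hm)),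
      (g : GL (Fin 3) L) ∈
          Literature.NumberTheory.Automorphic.UnitaryGroup.arithmeticLevel (↥(maximalRealSubfield L)) L
            (IsCMField.complexConj L) 3 V.Hm K →
        ∃ x : (V.latticeModel printFact_unitaryCompact_holds).G,
          x ∈ satLevelRegimeOf V hV K ∧
            ιinf (BallRational.toBall L ι₁ V.Hm V.sylvesterFrame (sylvesterFrame_J V) g) * x ∈
                (V.latticeModel printFact_unitaryCompact_holds).Γ ∧
              ∀ y : U21, Commute x (ιinf y)

namespace ThetaAdelicSide

variable {L : CMField} {ι₁ : L →+* ℂ} {V : HermSpace3 L ι₁} {c : SeesawCtx L} (S : ThetaAdelicSide V c)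

/-- **E's `hRat` from the splitting** (glue-1-g4 `E2InstanceR12`, level-free form): every rational point has a
`G_U(𝔸)`-corrector into `G_U(L⁺)` commuting with the archimedean component. Kernel: `rat_split` + `comm_fin`. -/
theorem hRat (γ : U21) (hγ : γ ∈ BallRational.ratImage L ι₁ V.Hm V.sylvesterFrame (sylvesterFrame_J V)) :
    ∃ k : (V.latticeModel printFact_unitaryCompact_holds).G,
      S.ιinf γ * k ∈ (V.latticeModel printFact_unitaryCompact_holds).Γ ∧ ∀ x : U21, Commute k (S.ιinf x) := by
  obtain ⟨k, hk, h⟩ := S.rat_split γ hγ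
  exact ⟨k, h, fun x => S.comm_fin x k hk⟩

/-- The same corrector lands in the arithmetic subgroup `(S.P k).ΓU` of each pair datum (`hΓU`). -/
theorem hRat_ΓU (i : Fin 4) (γ : U21)
    (hγ : γ ∈ BallRational.ratImage L ι₁ V.Hm V.sylvesterFrame (sylvesterFrame_J V)) :
    ∃ k : (V.latticeModel printFact_unitaryCompact_holds).G,
      S.ιinf γ * k ∈ (S.P i).ΓU ∧ ∀ x : U21, Commute k (S.ιinf x) := by
  rw [S.hΓU i]; exact S.hRat γ hγ

/-- `[G_U]` of the pair data is compact: the regime model's cocompactness (Godement, kernel). -/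
instance compactSpace_quot (k : Fin 4) :
    CompactSpace ((V.latticeModel printFact_unitaryCompact_holds).G ⧸ (S.P k).ΓU) := by
  rw [S.hΓU k]; infer_instance

end ThetaAdelicSide

/-! ### § 3. The pin -/

section Pin

variable (hHD : exists_isReal_hodgeModel) (hI : hodgePQ_independent_of_hodgeModel)
  (h₁ : BallQuotientUniformised)  (h₃ : CMAbelianVarietyRealised)

variable {L : CMField} {ι₁ : L →+* ℂ} {V : HermSpace3 L ι₁} {c : SeesawCtx L}

/-- **The Sylvester frame** of the ball-quotient datum of `X_Γ`: the UNIFORM frame `Model.ballFrame` of the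
period lane (`Model/BallInstance`, mc-period-1) — the matrix `V.sylvesterFrame`, the SAME at every level `Γ`, so
that the pin's class maps `D Γ`, the realised ball `Model.ballOf` (`ball.ev`, E's `transl`) and the level-lowering
covers (`thetaSat`, (H″) `pull_baseChange_mem_thetaClasses_of_le`, which needs the frames at `Γ' ≤ Γ` to have
the same matrix — `rfl` here) all read the ball in ONE frame (junction «FRAME», period-1-g3 2026-08-19). -/
def frameOf (Γ : Level V) (h : IsAnisotropic L V.Hm) :
    (ballDatumOf (hHD := hHD) (hI := hI) (hU := ballQuotientUniformisedDatum_of h₁) (h₃ := h₃)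
      L ι₁ V Γ h).SylvesterFrame :=
  ballFrame hHD hI h₁ h₃ Γ h

/-- (Ported verbatim from the HodgeCMPerL package; no docstring in the source.) -/
@[simp] theorem frameOf_eq (Γ : Level V) (h : IsAnisotropic L V.Hm) :
    frameOf hHD hI h₁ h₃ Γ h = ballFrame hHD hI h₁ h₃ Γ h := rfl

/-- The frame MATRIX is level-independent: `(frameOf Γ h).t = V.sylvesterFrame`. -/
theorem frameOf_t (Γ : Level V) (h : IsAnisotropic L V.Hm) :
    (frameOf hHD hI h₁ h₃ Γ h).t = (V.sylvesterFrame : Matrix (Fin 3) (Fin 3) ℂ) := rfl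

/-- The level group `Δ_Γ = ρ_𝔣(Γ) ≤ U(2,1)` in the chosen frame (regime). -/
def levelImage (Γ : Level V) (h : IsAnisotropic L V.Hm) : Subgroup U21 :=
  (ballDatumOf (hHD := hHD) (hI := hI) (hU := ballQuotientUniformisedDatum_of h₁) (h₃ := h₃)
    L ι₁ V Γ h).ballImage (frameOf hHD hI h₁ h₃ Γ h)

/-- **The group of the ball datum of `X_Γ`, read in `GL₃(ℂ)`, is `ι₁(Γ)`** (coding lemmas `PMSRealisation.datum_Γ` and
`PicardCode.ofHermitian_Γ_map`).  (RUN-38: moved here, name and namespace unchanged, from `Model/ThetaSatDischarge`, so that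
the pin reads level images back in `U(V)(L⁺)`; its users `levelImage_mono`, `HLevDischarge.conj_mem_levelImage` are
downstream of this file.) -/
theorem ballDatumOf_Γ_map (hU : BallQuotientUniformisedDatum) (Γ : Level V) (h : IsAnisotropic L V.Hm) :
    (ballDatumOf (hHD := hHD) (hI := hI) (hU := hU) (h₃ := h₃) L ι₁ V Γ h).Γ.map
        (Matrix.GeneralLinearGroup.map
          ((ballDatumOf (hHD := hHD) (hI := hI) (hU := hU) (h₃ := h₃) L ι₁ V Γ h).E.subtype :
            (ballDatumOf (hHD := hHD) (hI := hI) (hU := hU) (h₃ := h₃) L ι₁ V Γ h).E →+* ℂ)) =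
      Γ.Γ.map (Matrix.GeneralLinearGroup.map ι₁) :=
  ((pmsRealisation hU (pmsCode L ι₁ V Γ)).datum_Γ _).trans
    (PicardCode.ofHermitian_Γ_map ι₁ V.Hm Γ.Γ V.isHermitian V.signature_ι₁ V.posDef_of_ne Γ.isCongruence
      Γ.torsionFree)

/-- **Level images come from level-`Γ.K` rational points**: every `δ ∈ ρ_𝔣(Γ)` is `toBall g` for some rational
`g ∈ U(V)(L⁺)` lying in `U(V)(L⁺) ∩ Γ.K = Γ` ((W1) `Level.arithmeticLevel_K`), read along the uniform Sylvester frame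
(the coding of `HLevDischarge.conj_mem_levelImage`, run once: `ballImage = map (ballRep 𝔣) ⊤`, `ballDatumOf_Γ_map`,
`mat_ballRep`/`mat_toBall`, `(frameOf Γ h).t = V.sylvesterFrame`). -/
theorem exists_toBall_eq_of_mem_levelImage (Γ : Level V) (h : IsAnisotropic L V.Hm) {δ : U21}
    (hδ : δ ∈ levelImage hHD hI h₁ h₃ Γ h) :
    ∃ g : ↥(Literature.AlgebraicGeometry.ShimuraVarieties.unitaryGroup (IsCMField.complexConj L : L →+* L) V.Hm),
      (g : GL (Fin 3) L) ∈
          Literature.NumberTheory.Automorphic.UnitaryGroup.arithmeticLevel (↥(maximalRealSubfield L)) L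
            (IsCMField.complexConj L) 3 V.Hm Γ.K ∧
        BallRational.toBall L ι₁ V.Hm V.sylvesterFrame (sylvesterFrame_J V) g = δ := by
  rw [levelImage, UnitaryBallUniformisationDatum.ballImage, Subgroup.mem_map] at hδ
  obtain ⟨γ', -, rfl⟩ := hδ
  -- `γ' ∈ Γ_{D_Γ}` is the image of some `g₀ ∈ Γ`
  have h1 : Matrix.GeneralLinearGroup.map
      ((ballDatumOf (hHD := hHD) (hI := hI) (hU := ballQuotientUniformisedDatum_of h₁) (h₃ := h₃)
        L ι₁ V Γ h).E.subtype : _ →+* ℂ) (γ' : GL (Fin 3) _) ∈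
        Γ.Γ.map (Matrix.GeneralLinearGroup.map ι₁) := by
    rw [← ballDatumOf_Γ_map hHD hI h₃ (ballQuotientUniformisedDatum_of h₁) Γ h]
    exact Subgroup.mem_map_of_mem _ γ'.2
  obtain ⟨g₀, hg₀, hg₀e⟩ := h1
  -- `Γ ≤ U(V)(L⁺)` (`Level.isCongruence`; the CM conjugation coerced to a ring hom is `conjRingHomK L`)
  have hconj : (IsCMField.complexConj L : L →+* L) = conjRingHomK L := RingHom.ext fun _ => rfl
  have hg₀U : g₀ ∈ Literature.AlgebraicGeometry.ShimuraVarieties.unitaryGroup (IsCMField.complexConj L : L →+* L) V.Hm := by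
    rw [hconj]; exact Γ.isCongruence.1 hg₀
  refine ⟨⟨g₀, hg₀U⟩, ?_, ?_⟩
  · rw [Γ.arithmeticLevel_K]; exact hg₀
  · -- compare matrices in `GL₃(ℂ)`: both are `T⁻¹ · ι₁(g₀) · T`, `T = V.sylvesterFrame`
    have e1 : ((γ'.1 : GL (Fin 3) _) : Matrix (Fin 3) (Fin 3) _).map
        (ballDatumOf (hHD := hHD) (hI := hI) (hU := ballQuotientUniformisedDatum_of h₁) (h₃ := h₃) L ι₁ V Γ h).τ₁ =
          ((g₀ : GL (Fin 3) L) : Matrix (Fin 3) (Fin 3) L).map ι₁ := by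
      simpa [Matrix.GeneralLinearGroup.val_map_apply] using
        congrArg (fun x : GL (Fin 3) ℂ => (x : Matrix (Fin 3) (Fin 3) ℂ)) hg₀e.symm
    have hT : (frameOf hHD hI h₁ h₃ Γ h).t = (V.sylvesterFrame : Matrix (Fin 3) (Fin 3) ℂ) := rfl
    have hTi : (frameOf hHD hI h₁ h₃ Γ h).ti =
        ((V.sylvesterFrame⁻¹ : GL (Fin 3) ℂ) : Matrix (Fin 3) (Fin 3) ℂ) := rfl
    apply Subtype.ext
    apply Units.ext
    change Literature.Geometry.ComplexHyperbolic.BallModel.mat _ =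
      Literature.Geometry.ComplexHyperbolic.BallModel.mat _
    rw [BallRational.mat_toBall, UnitaryBallUniformisationDatum.mat_ballRep, hT, hTi, ← e1]

namespace ThetaAdelicSide

/-- **(L3) at the pin**: every `δ ∈ ρ_𝔣(Γ)` has a corrector in the saturation regime of `Γ.K` into `G_U(L⁺)` commuting
with the archimedean component — the field `rat_split_level` read through `exists_toBall_eq_of_mem_levelImage`.  This is
verbatim the residual hypothesis `hcorr` of kit #S11's (T4) `exists_adm₃₄_coe_eq_rightTranslate_of_mem_Gfin`. -/
theorem exists_corrector_of_mem_levelImage (S : ThetaAdelicSide V c) (Γ : Level V) (h : IsAnisotropic L V.Hm) :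
    ∀ δ ∈ levelImage hHD hI h₁ h₃ Γ h, ∃ x : (V.latticeModel printFact_unitaryCompact_holds).G,
      x ∈ satLevelRegimeOf V h Γ.K ∧
        S.ιinf δ * x ∈ (V.latticeModel printFact_unitaryCompact_holds).Γ ∧ ∀ y : U21, Commute x (S.ιinf y) := by
  intro δ hδ
  obtain ⟨g, hg, rfl⟩ := exists_toBall_eq_of_mem_levelImage hHD hI h₁ h₃ Γ h hδ
  exact S.rat_split_level h Γ.K g hg

end ThetaAdelicSide

/-- **The theta-space input IN THE REGIME** `h`: geometric half pinned (`U21`, `Stab(x₀)`, `weightOf x₀`,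
`Δ Γ := ballImage 𝔣_Γ`, `D Γ := classMapDatumOf …`), adelic half from `S`. -/
def thetaSpaceInputIn (S : ThetaAdelicSide V c) (h : IsAnisotropic L V.Hm) :
    ThetaSpaceInput (picardCMUniverse hHD hI h₁ h₃) V c where
  G₁ := U21
  K₁ := stabilizer U21 x₀
  κ₁ := (stabilizer U21 x₀).subtype
  W := Fin 2 → ℂ
  τ₁ := BallForms.isPullbackCocycle_cotangentCocycle.weightOf x₀
  Δ := fun Γ => levelImage hHD hI h₁ h₃ Γ h
  D := fun Γ => classMapDatumOf hHD hI h₁ h₃ Γ h (frameOf hHD hI h₁ h₃ Γ h) (MonoidHom.id U21)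
    (isLevelCorrected_id (levelImage hHD hI h₁ h₃ Γ h) (stabilizer U21 x₀).subtype
      (BallForms.isPullbackCocycle_cotangentCocycle.weightOf x₀))
    (isWeightMatched_id (stabilizer U21 x₀).subtype (BallForms.isPullbackCocycle_cotangentCocycle.weightOf x₀))
  K := maximalRealSubfield L
  L := L
  J := Fin 3
  GU := (V.latticeModel printFact_unitaryCompact_holds).G
  P := S.P
  ιinf := fun _ => S.ιinf
  KΓ := fun Γ => satLevelRegimeOf V h Γ.K

/-- The theta-space input OFF the regime (never evaluated by the PerL cone): level groups `⊥`, zero class-map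
data, adelic half from `S`. -/
def thetaSpaceInputOff (S : ThetaAdelicSide V c) : ThetaSpaceInput (picardCMUniverse hHD hI h₁ h₃) V c where
  G₁ := U21
  K₁ := stabilizer U21 x₀
  κ₁ := (stabilizer U21 x₀).subtype
  W := Fin 2 → ℂ
  τ₁ := BallForms.isPullbackCocycle_cotangentCocycle.weightOf x₀
  Δ := fun _ => ⊥
  D := fun Γ => zeroClassMapDatum (MonoidHom.id U21)
    (isLevelCorrected_id ⊥ (stabilizer U21 x₀).subtype (BallForms.isPullbackCocycle_cotangentCocycle.weightOf x₀))
    (isWeightMatched_id (stabilizer U21 x₀).subtype (BallForms.isPullbackCocycle_cotangentCocycle.weightOf x₀))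
    ((picardCMUniverse hHD hI h₁ h₃).CohC ((picardCMUniverse hHD hI h₁ h₃).pms L ι₁ V Γ) 1)
  K := maximalRealSubfield L
  L := L
  J := Fin 3
  GU := (V.latticeModel printFact_unitaryCompact_holds).G
  P := S.P
  ιinf := fun _ => S.ιinf
  KΓ := fun _ => ⊥

open scoped Classical in
/-- **The pin `X := (B)`** of the E binder `X`: the regime branch when `V.Hm` is anisotropic, else the
off-regime input. -/
def thetaSpaceInputOf
    (S : ∀ {L : CMField} {ι₁ : L →+* ℂ} (V : HermSpace3 L ι₁) (c : SeesawCtx L), ThetaAdelicSide V c)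
    {L : CMField} {ι₁ : L →+* ℂ} (V : HermSpace3 L ι₁) (c : SeesawCtx L) :
    ThetaSpaceInput (picardCMUniverse hHD hI h₁ h₃) V c :=
  if h : IsAnisotropic L V.Hm then thetaSpaceInputIn hHD hI h₁ h₃ (S V c) h
  else thetaSpaceInputOff hHD hI h₁ h₃ (S V c)

variable (S : ∀ {L : CMField} {ι₁ : L →+* ℂ} (V : HermSpace3 L ι₁) (c : SeesawCtx L), ThetaAdelicSide V c)

/-- (Ported verbatim from the HodgeCMPerL package; no docstring in the source.) -/
theorem thetaSpaceInputOf_of_isAnisotropic (V : HermSpace3 L ι₁) (c : SeesawCtx L) (h : IsAnisotropic L V.Hm) :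
    thetaSpaceInputOf hHD hI h₁ h₃ S V c = thetaSpaceInputIn hHD hI h₁ h₃ (S V c) h := by
  classical
  exact dif_pos h

/-- (Ported verbatim from the HodgeCMPerL package; no docstring in the source.) -/
theorem thetaSpaceInputOf_of_not_isAnisotropic (V : HermSpace3 L ι₁) (c : SeesawCtx L)
    (h : ¬ IsAnisotropic L V.Hm) :
    thetaSpaceInputOf hHD hI h₁ h₃ S V c = thetaSpaceInputOff hHD hI h₁ h₃ (S V c) := by
  classical
  exact dif_neg h

/-- In the regime `2 < [L:ℚ]` the pin is the regime branch. -/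
theorem thetaSpaceInputOf_of_two_lt (V : HermSpace3 L ι₁) (c : SeesawCtx L) (Γ : Level V)
    (hL : 2 < Module.finrank ℚ L) :
    thetaSpaceInputOf hHD hI h₁ h₃ S V c =
      thetaSpaceInputIn hHD hI h₁ h₃ (S V c) (isAnisotropic_of_two_lt L ι₁ V Γ hL) :=
  thetaSpaceInputOf_of_isAnisotropic hHD hI h₁ h₃ S V c _

/-- **The END STATE's `Θ_k(Γ)` at the pin, in the regime**: the theta classes through (C2)'s class-map datum of
the classical theta space of the pair data `P k`. -/
theorem thetaOf_thetaSpaceInputOf_of_isAnisotropic (V : HermSpace3 L ι₁) (c : SeesawCtx L) (k : Fin 4)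
    (Γ : Level V) (h : IsAnisotropic L V.Hm) :
    thetaOf _ (thetaClassInputOf _ (fun V c => thetaSpaceInputOf hHD hI h₁ h₃ S V c)) V c k Γ =
      thetaClasses (MonoidHom.id U21) ((thetaSpaceInputIn hHD hI h₁ h₃ (S V c) h).D Γ)
        ((thetaSpaceInputIn hHD hI h₁ h₃ (S V c) h).Θ k Γ) := by
  rw [thetaOf_thetaClassInputOf, thetaSpaceInputOf_of_isAnisotropic hHD hI h₁ h₃ S V c h]
  rfl


-- port_pkg: scope closed for this part
end Pin
end Model
end HodgeCM
end
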